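/- Copyright: the b2b-balaban cell (near-miss cell 7), T⁴-continuum fan-out, ROUND-2 swarm of lineage t4-ne7b-p1
(node U5c COUNT member), seat t4-ne7b-formalise-leaf-08 (gen 7).  Released under the licence of the surrounding project. -/
import Summits.QuantumFields.BalabanUV.T4Continuum.Support.HistoryConstantsSlackRecord
import Summits.QuantumFields.BalabanUV.T4Continuum.Support.HistoryZoneEvolve

/-!
# History constants: THE CONSTANTS-SIDE CENSUS OF THE END OF RECORD v3 (the slack ∕ T3b road)

Summits-side support leaf of the T⁴-continuum cell (rung (B)+1 on a FINITE torus only; NOT infinite volume, NOT the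
mass gap, NOT the Clay statement; NOT a proof of the spine estimate NE7b).  Claim table
`t4/b2b-balaban-t4-ne7b-p1/LEAVES-NE7b.md` (junction of rows S9c ∕ S10 ∕ OI-17's `HistoryConstantsSlackRecord` with the
END OF RECORD v3 `HistoryRealiseCellsRunMultEnd.hybridNE7_of_realisedDomainsRun_printedT3b`, R-OWNER-23-9).

WHY.  END v3 (and its END-B sibling `…MultEndD`) carries NO `Dominates C O`; its constants-side antecedent is the bundle
{`h : ThresholdOK C L rr β₀` (hence `0 < C.a`), `hslack : C.a + θ ≤ ½γ₀A₁²`, the S6g′-instance's stride∕decay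
arithmetic `hsS ∕ hsmall ∕ hθc0 ∕ hθc1 ∕ hθcs`, and `hθJ : ΘJ(d, sS, θc) + 8·2^d·log(2d+1) ≤ θ`} — the class-linear
constant `θ` of the slot multiplicity is «slack-paid» at the profile floor `p₀ ≥ 1` (typer T-NE7b-14;
`HistoryConstantsSlack.linear_le_slackT`).  This file books what that bundle DEMANDS of print's displayed constants
`γ₀` ((1.77)) and `A₁` (ledger R4), when it is satisfiable, and the alternative home that removes the demand.

WHAT (all [folklore] real arithmetic on the lineage's OWN records `T4PrintedShapeBanking.Consts` ∕
`HistoryConstants.PrintedO1s` and on the letters of END v3 pasted VERBATIM; the tree's own vocabulary only —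
`PlacementBatch.lowerA`, `CountThresholdUniform.ThresholdOK`, `HistoryConstantsBridge.printedConsts`,
`HistoryConstantsSlack.slackT`, `HistoryZoneEvolve.cth`; NO definition, no `Prop` fact minted, nothing printed asserted,
no symbolic constant of a landed END specialised — trigger conditions c1∕c2∕c6):
* §1 **THE COUNT-SIDE ARITHMETIC IS SATISFIABLE ON EVERY REFINEMENT FACTOR**: `cth_one` (`cth c 1 k = (c+1)·k`),
  **`exists_stride`** (`2 ≤ L ⇒ ∃ sS ≥ 1` with END v3's `hsmall`, by `n^d·(½)^n → 0`), **`exists_decay`**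
  (`1 ≤ sS ⇒ ∃ θc ∈ [0,1)` with `½ ≤ θc^sS`, Bernoulli at `θc := 1 − 1∕(2sS)`), **`exists_stride_decay`**.
* §2 **THE FLOOR OF THE CLASS-LINEAR CONSTANT**: **`theta_floor`** — END v3's `hθJ` (left side verbatim) with
  `0 ≤ θc < 1`, `1 ≤ sS` forces `8·8710^d ≤ θ` (`8710 = 67·65·2`: the first fraction of `ΘJ` alone, `cth 32 1 sS ≥ 33`).
* §3 **THE LOCATED DEMAND ON PRINT's `½γ₀A₁²`**: **`demand_of_slack`** (`ThresholdOK ∧ hslack ∧ Θ ≤ θ ⇒ Θ < ½γ₀A₁²`),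
  **`half_gamma_A1_sq_gt_of_END3`** (`⇒ 8·8710^d < ½γ₀A₁²`), **`half_gamma_A1_sq_gt_of_END3_four`** (`d = 4`:
  `46 042 893 350 480 000 < ½γ₀A₁²`), **`not_exists_END3_consts_of_le`** (no record at all when `½γ₀A₁² ≤ 8·8710^d`).
  END v2 (`Dominates C O`, p216885) admitted EVERY positive `O` (`HistoryConstantsExist.exists_thresholdOK_refines`,
  `HistoryConstantsSlackRecord.slackEND_constants_half`); END v3 as homed is non-vacuous only above this absolute floor.
  Print fixes no numerals (c2): this is a DISPLAYED DEMAND, booked — not a refutation of anything.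
* §4 **SATISFIABLE ABOVE THE DEMAND**: **`exists_consts_END3`** — for `O.Pos`, `0 ≤ θ < ½γ₀A₁²`, any `d`, `L ≥ 1`, `rr`,
  ONE record `C` (the print-shaped record over explicit margins, lowered by `θ`) and `β₀ := 1∕L` meet EVERY `C`-side
  binder of END v3 and of the apex (`ThresholdOK`, `0 < μ`, `κ₁`- and `E₀`-largeness, `1 ≤ A₀`, `13 ≤ n₁`, `0 < E₂`,
  `0 ≤ E₃`, `hslack`, `0 < β₀`, `L·β₀ ≤ 1`) AND `Dominates C O`; **`END3_consts_iff`** — the full constants-side bundle of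
  END v3 is inhabited IFF `ΘJ(d,sS,θc) + 8·2^d·log(2d+1) < ½γ₀A₁²` for some admissible stride∕decay `(sS, θc)`.
* §5 sanity (`L = 2`, `d = 4`).  The repair — `θ` re-homed against the profile at the infrared threshold, so that the
  demand moves from print's constants to the coupling window — is the owner's row S12j (R-OWNER-23-10), not this file.

HONEST.  Bookkeeping between typed interfaces of the same lineage; discharges nothing of H3 ∕ (B) ∕ BetaPertH ∕ NE7c ∕
NE7; which reading of [B16]'s «constants chosen sufficiently large» covers `A₁` is a literature question, not answered
here.  NE7b NOT proved; spine 0∕9.  HONEST DEPENDENCY (cell): continuum YM on T⁴ ⇐ BetaPertH ∧ nine spine estimates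
(0/9 proved); BetaPertH ⇐ (D1) ∧ (D4) ∧ CAP+tail; G-an2-4 gates asym, D1 and NE2/3/4. -/

open Filter
open Literature.MathematicalPhysics.QuantumFieldTheory.Balaban1983to89
open T4PersistenceDictionary T4PrintedShapeBanking T4CanonicalMenus
open Summit.QuantumFields.BalabanUV.T4Continuum.PlacementBatch
open Summit.QuantumFields.BalabanUV.T4Continuum.CountThresholdUniform
open Summit.QuantumFields.BalabanUV.T4Continuum.HistoryConstants
open Summit.QuantumFields.BalabanUV.T4Continuum.HistoryConstantsExist
open Summit.QuantumFields.BalabanUV.T4Continuum.HistoryConstantsSlackRecord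
open Summit.QuantumFields.BalabanUV.T4Continuum.HistoryZoneEvolve (cth)

namespace Summit.QuantumFields.BalabanUV.T4Continuum.HistoryConstantsSlackT3b

noncomputable section

/-! ## §1 The count-side stride ∕ decay arithmetic of END v3 is satisfiable on every refinement factor `L ≥ 2` -/

section Stride

/-- the thickening radius on the unit grid: `cth c 1 k = (c + 1)·k` (so `cth 32 1 sS = 33·sS`) [folklore] -/
theorem cth_one (c : ℕ) : ∀ k : ℕ, cth c 1 k = (c + 1) * k
  | 0 => by simp [cth]
  | k + 1 => by rw [cth, cth_one c k, Nat.div_one]; ring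

/-- `cth 32 1 sS ≥ 33` once `sS ≥ 1` [folklore] -/
theorem cth_32_ge {sS : ℕ} (hsS : 1 ≤ sS) : 33 ≤ cth 32 1 sS := by
  rw [cth_one]; omega

/-- **THE STRIDE EXISTS**: for every dimension `d` and every refinement factor `L ≥ 2` there is a stride `sS ≥ 1` meeting
END v3's smallness binder `hsmall` verbatim — `(2·cth 32 1 sS + 1)^d·5^d·max 1 66 ≤ L^{sS∕2}∕2` (natural-number exponent
`sS ∕ 2`).  Proof: an even stride `sS = 2m` with `132·665^d·m^d < 2^m ≤ L^m` (`m^d·(½)^m → 0`). [folklore] -/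
theorem exists_stride (d : ℕ) {L : ℕ} (hL : 2 ≤ L) :
    ∃ sS : ℕ, 1 ≤ sS ∧
      (((2 * cth 32 1 sS + 1) ^ d : ℕ) : ℝ) * (5 : ℝ) ^ d * ((max 1 (2 * 32 + 2) : ℕ) : ℝ) ≤
        (L : ℝ) ^ (sS / 2) / 2 := by
  have hlim := tendsto_pow_const_mul_const_pow_of_abs_lt_one d (show |(1 / 2 : ℝ)| < 1 by
    rw [abs_of_nonneg (by norm_num)]; norm_num)
  have hε : (0 : ℝ) < 1 / (132 * 665 ^ d) := by positivity
  obtain ⟨m, hm, hm1⟩ := ((hlim.eventually (gt_mem_nhds hε)).and (eventually_ge_atTop 1)).exists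
  refine ⟨2 * m, by omega, ?_⟩
  have hdiv : 2 * m / 2 = m := by omega
  have hmax : ((max 1 (2 * 32 + 2) : ℕ) : ℝ) = 66 := by norm_num
  rw [hdiv, hmax, cth_one]
  push_cast
  have hm1' : (1 : ℝ) ≤ m := by exact_mod_cast hm1
  have h5 : ((2 * (33 * (2 * (m : ℝ))) + 1) * 5) ^ d ≤ (665 * (m : ℝ)) ^ d :=
    pow_le_pow_left₀ (by positivity) (by linarith) d
  have hpos2 : (0 : ℝ) < 2 ^ m := by positivity
  have hlt : 132 * 665 ^ d * (m : ℝ) ^ d < 2 ^ m := by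
    have h1 : (m : ℝ) ^ d * (1 / 2 : ℝ) ^ m < 1 / (132 * 665 ^ d) := hm
    rw [one_div_pow, mul_one_div, div_lt_div_iff₀ hpos2 (by positivity), one_mul] at h1
    linarith
  have hL2 : (2 : ℝ) ^ m ≤ (L : ℝ) ^ m := pow_le_pow_left₀ (by norm_num) (by exact_mod_cast hL) m
  calc (2 * (33 * (2 * (m : ℝ))) + 1) ^ d * 5 ^ d * 66
      = ((2 * (33 * (2 * (m : ℝ))) + 1) * 5) ^ d * 66 := by rw [mul_pow]
    _ ≤ (665 * (m : ℝ)) ^ d * 66 := by gcongr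
    _ = 665 ^ d * (m : ℝ) ^ d * 66 := by rw [mul_pow]
    _ ≤ (L : ℝ) ^ m / 2 := by
        rw [le_div_iff₀ (by norm_num : (0 : ℝ) < 2)]
        nlinarith [(by positivity : (0 : ℝ) ≤ (665 : ℝ) ^ d * (m : ℝ) ^ d)]

/-- **THE DECAY EXISTS**: for every stride `sS ≥ 1` there is `θc ∈ [0, 1)` with `½ ≤ θc^{sS}` — Bernoulli's inequality at
`θc := 1 − 1∕(2sS)`. [folklore] -/
theorem exists_decay {sS : ℕ} (hsS : 1 ≤ sS) : ∃ θc : ℝ, 0 ≤ θc ∧ θc < 1 ∧ 1 / 2 ≤ θc ^ sS := by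
  have hs : (1 : ℝ) ≤ sS := by exact_mod_cast hsS
  have hs0 : (0 : ℝ) < sS := by linarith
  refine ⟨1 - 1 / (2 * sS), ?_, ?_, ?_⟩
  · have : 1 / (2 * (sS : ℝ)) ≤ 1 / 2 := by
      rw [div_le_div_iff₀ (by positivity) (by norm_num)]; linarith
    linarith
  · have : 0 < 1 / (2 * (sS : ℝ)) := by positivity
    linarith
  · have hB := one_add_mul_le_pow (show (-2 : ℝ) ≤ -(1 / (2 * sS)) by
      have : 1 / (2 * (sS : ℝ)) ≤ 1 / 2 := by
        rw [div_le_div_iff₀ (by positivity) (by norm_num)]; linarith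
      linarith) sS
    have hhalf : 1 + (sS : ℝ) * -(1 / (2 * sS)) = 1 / 2 := by field_simp; ring
    rw [hhalf] at hB
    simpa only [sub_eq_add_neg] using hB

/-- **STRIDE AND DECAY TOGETHER**: on every refinement factor `L ≥ 2`, in every dimension, END v3's five count-side
arithmetic binders `hsS`, `hsmall`, `hθc0`, `hθc1`, `hθcs` are jointly satisfiable. [folklore] -/
theorem exists_stride_decay (d : ℕ) {L : ℕ} (hL : 2 ≤ L) :
    ∃ sS : ℕ, ∃ θc : ℝ, 1 ≤ sS ∧
      (((2 * cth 32 1 sS + 1) ^ d : ℕ) : ℝ) * (5 : ℝ) ^ d * ((max 1 (2 * 32 + 2) : ℕ) : ℝ) ≤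
          (L : ℝ) ^ (sS / 2) / 2 ∧
      0 ≤ θc ∧ θc < 1 ∧ 1 / 2 ≤ θc ^ sS := by
  obtain ⟨sS, hsS, hsmall⟩ := exists_stride d hL
  obtain ⟨θc, h0, h1, hs⟩ := exists_decay hsS
  exact ⟨sS, θc, hsS, hsmall, h0, h1, hs⟩

end Stride

/-! ## §2 The floor of the class-linear constant `θ` forced by END v3's `hθJ` -/

section Floor

/-- **THE FLOOR OF `θ`**: END v3's binder `hθJ` (its left side pasted VERBATIM from
`HistoryRealiseCellsRunMultEnd.hybridNE7_of_realisedDomainsRun_printedT3b`, p222172) together with `0 ≤ θc < 1` and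
`1 ≤ sS` forces `8·8710^d ≤ θ`: every summand is nonnegative, and the first fraction alone is
`≥ 2·(2·cth 32 1 sS + 1)^d·(65^d·4·2^d) ≥ 8·(67·65·2)^d`. [folklore] -/
theorem theta_floor {d sS : ℕ} {θc θ : ℝ} (hθc0 : 0 ≤ θc) (hθc1 : θc < 1) (hsS : 1 ≤ sS)
    (hθJ : (2 +
            ((2 * (((2 * cth 32 1 sS + 1) ^ d : ℕ) : ℝ) * ((((2 * 32 + 1) ^ d : ℕ) : ℝ) * (4 * 2 ^ d)) +
                  4 * ((((2 * cth 32 1 sS + 1) ^ d : ℕ) : ℝ) * (5 : ℝ) ^ d)) / (1 - θc) +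
              2 * (2 * ((((2 * cth 32 1 sS + 1) ^ d : ℕ) : ℝ) * (5 : ℝ) ^ d))) +
            (2 * ((0 + 2 * Real.log (2 * d + 1)) + (2 * (d : ℝ) + 2 * Real.log (2 * d + 1)) *
                  (((max 1 (2 * 32 + 2) : ℕ) : ℝ) * (2 * ((((2 * cth 32 1 sS + 1) ^ d : ℕ) : ℝ) * (5 : ℝ) ^ d)))) +
              (2 * (d : ℝ) + 2 * Real.log (2 * d + 1)) * 1 *
                (((max 1 (2 * 32 + 2) : ℕ) : ℝ) *
                    ((2 * (((2 * cth 32 1 sS + 1) ^ d : ℕ) : ℝ) * ((((2 * 32 + 1) ^ d : ℕ) : ℝ) * (4 * 2 ^ d)) +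
                        4 * ((((2 * cth 32 1 sS + 1) ^ d : ℕ) : ℝ) * (5 : ℝ) ^ d)) / (1 - θc)) +
                  4 * 2 ^ d)) +
            10) + 8 * 2 ^ d * Real.log (2 * d + 1) ≤ θ) :
    (8 : ℝ) * 8710 ^ d ≤ θ := by
  set X : ℝ := (((2 * cth 32 1 sS + 1) ^ d : ℕ) : ℝ) with hXdef
  set W : ℝ := ((((2 * 32 + 1) ^ d : ℕ) : ℝ)) with hWdef
  set M : ℝ := (((max 1 (2 * 32 + 2) : ℕ) : ℝ)) with hMdef
  set lg : ℝ := Real.log (2 * d + 1) with hlgdef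
  have hX : (67 : ℝ) ^ d ≤ X := by
    have h67 : 67 ≤ 2 * cth 32 1 sS + 1 := by have := cth_32_ge hsS; omega
    rw [hXdef]; exact_mod_cast Nat.pow_le_pow_left h67 d
  have hX0 : 0 ≤ X := le_trans (by positivity) hX
  have hW : W = (65 : ℝ) ^ d := by rw [hWdef]; push_cast; norm_num
  have hM : M = 66 := by rw [hMdef]; norm_num
  have hlg : 0 ≤ lg := Real.log_nonneg (by have : (0 : ℝ) ≤ d := Nat.cast_nonneg d; linarith)
  have hd : (0 : ℝ) ≤ d := Nat.cast_nonneg d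
  have h1 : 0 < 1 - θc := by linarith
  have h1' : 1 - θc ≤ 1 := by linarith
  have hP : (0 : ℝ) ≤ 2 ^ d := by positivity
  have hF : (0 : ℝ) ≤ (5 : ℝ) ^ d := by positivity
  have hW0 : 0 ≤ W := by rw [hW]; positivity
  -- the numerator of the first fraction and its floor
  set Q : ℝ := 2 * X * (W * (4 * 2 ^ d)) + 4 * (X * (5 : ℝ) ^ d) with hQdef
  have hQ0 : 0 ≤ Q := by rw [hQdef]; positivity
  have hQdiv : Q ≤ Q / (1 - θc) := le_div_self hQ0 h1 h1'
  have hQfloor : (8 : ℝ) * 8710 ^ d ≤ Q := by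
    have h8710 : (8710 : ℝ) ^ d = 67 ^ d * (65 ^ d * 2 ^ d) := by
      rw [show (8710 : ℝ) = 67 * (65 * 2) by norm_num, mul_pow, mul_pow]
    rw [hQdef, hW, h8710]
    have : (67 : ℝ) ^ d * (65 ^ d * 2 ^ d) ≤ X * (65 ^ d * 2 ^ d) :=
      mul_le_mul_of_nonneg_right hX (by positivity)
    nlinarith [mul_nonneg hX0 hF]
  have hrest1 : 0 ≤ 2 * (2 * (X * (5 : ℝ) ^ d)) := by positivity
  have hrest2 : 0 ≤ 2 * ((0 + 2 * lg) + (2 * (d : ℝ) + 2 * lg) * (M * (2 * (X * (5 : ℝ) ^ d)))) := by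
    rw [hM]; positivity
  have hrest3 : 0 ≤ (2 * (d : ℝ) + 2 * lg) * 1 * (M * (Q / (1 - θc)) + 4 * 2 ^ d) := by
    rw [hM]
    have : 0 ≤ Q / (1 - θc) := div_nonneg hQ0 h1.le
    positivity
  have hrest4 : 0 ≤ 8 * 2 ^ d * lg := by positivity
  have hθJ' : (2 + (Q / (1 - θc) + 2 * (2 * (X * (5 : ℝ) ^ d))) +
      (2 * ((0 + 2 * lg) + (2 * (d : ℝ) + 2 * lg) * (M * (2 * (X * (5 : ℝ) ^ d)))) +
        (2 * (d : ℝ) + 2 * lg) * 1 * (M * (Q / (1 - θc)) + 4 * 2 ^ d)) + 10) + 8 * 2 ^ d * lg ≤ θ := hθJ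
  linarith

end Floor

/-! ## §3 The located demand on print's `½γ₀A₁²` -/

section Demand

variable {C : T4PrintedShapeBanking.Consts} {O : PrintedO1s} {L rr : ℕ} {β₀ : ℝ}

/-- **THE DEMAND OF THE SLACK HOME**: under `ThresholdOK` (so `0 < a`) and `hslack : a + θ ≤ ½γ₀A₁²`, any floor `Θ ≤ θ`
of the class-linear constant is STRICTLY below print's `½γ₀A₁²`. [folklore] -/
theorem demand_of_slack (h : ThresholdOK C L rr β₀) {θ Θ : ℝ} (hslack : C.a + θ ≤ O.γ₀ * O.A₁ ^ 2 / 2)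
    (hΘ : Θ ≤ θ) : Θ < O.γ₀ * O.A₁ ^ 2 / 2 := by
  linarith [h.a_pos]

/-- **THE LOCATED DEMAND OF END v3 ON PRINT's CONSTANTS**: its constants-side binders `h`, `hslack`, `hθc0`, `hθc1`, `hsS`,
`hθJ` (verbatim) force `8·8710^d < ½γ₀A₁²`. [folklore] -/
theorem half_gamma_A1_sq_gt_of_END3 (h : ThresholdOK C L rr β₀) {θ : ℝ}
    (hslack : C.a + θ ≤ O.γ₀ * O.A₁ ^ 2 / 2) {d sS : ℕ} {θc : ℝ} (hθc0 : 0 ≤ θc) (hθc1 : θc < 1) (hsS : 1 ≤ sS)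
    (hθJ : (2 +
            ((2 * (((2 * cth 32 1 sS + 1) ^ d : ℕ) : ℝ) * ((((2 * 32 + 1) ^ d : ℕ) : ℝ) * (4 * 2 ^ d)) +
                  4 * ((((2 * cth 32 1 sS + 1) ^ d : ℕ) : ℝ) * (5 : ℝ) ^ d)) / (1 - θc) +
              2 * (2 * ((((2 * cth 32 1 sS + 1) ^ d : ℕ) : ℝ) * (5 : ℝ) ^ d))) +
            (2 * ((0 + 2 * Real.log (2 * d + 1)) + (2 * (d : ℝ) + 2 * Real.log (2 * d + 1)) *
                  (((max 1 (2 * 32 + 2) : ℕ) : ℝ) * (2 * ((((2 * cth 32 1 sS + 1) ^ d : ℕ) : ℝ) * (5 : ℝ) ^ d)))) +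
              (2 * (d : ℝ) + 2 * Real.log (2 * d + 1)) * 1 *
                (((max 1 (2 * 32 + 2) : ℕ) : ℝ) *
                    ((2 * (((2 * cth 32 1 sS + 1) ^ d : ℕ) : ℝ) * ((((2 * 32 + 1) ^ d : ℕ) : ℝ) * (4 * 2 ^ d)) +
                        4 * ((((2 * cth 32 1 sS + 1) ^ d : ℕ) : ℝ) * (5 : ℝ) ^ d)) / (1 - θc)) +
                  4 * 2 ^ d)) +
            10) + 8 * 2 ^ d * Real.log (2 * d + 1) ≤ θ) :
    (8 : ℝ) * 8710 ^ d < O.γ₀ * O.A₁ ^ 2 / 2 :=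
  demand_of_slack h hslack (theta_floor hθc0 hθc1 hsS hθJ)

/-- **ON T⁴ (`d = 4`)**: END v3's constants-side binders force `½γ₀A₁² > 46 042 893 350 480 000` (`= 8·8710⁴`,
`≈ 4.6·10¹⁶`). [folklore] -/
theorem half_gamma_A1_sq_gt_of_END3_four (h : ThresholdOK C L rr β₀) {θ : ℝ}
    (hslack : C.a + θ ≤ O.γ₀ * O.A₁ ^ 2 / 2) {sS : ℕ} {θc : ℝ} (hθc0 : 0 ≤ θc) (hθc1 : θc < 1) (hsS : 1 ≤ sS)
    (hθJ : (2 +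
            ((2 * (((2 * cth 32 1 sS + 1) ^ 4 : ℕ) : ℝ) * ((((2 * 32 + 1) ^ 4 : ℕ) : ℝ) * (4 * 2 ^ 4)) +
                  4 * ((((2 * cth 32 1 sS + 1) ^ 4 : ℕ) : ℝ) * (5 : ℝ) ^ 4)) / (1 - θc) +
              2 * (2 * ((((2 * cth 32 1 sS + 1) ^ 4 : ℕ) : ℝ) * (5 : ℝ) ^ 4))) +
            (2 * ((0 + 2 * Real.log (2 * (4 : ℕ) + 1)) + (2 * ((4 : ℕ) : ℝ) + 2 * Real.log (2 * (4 : ℕ) + 1)) *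
                  (((max 1 (2 * 32 + 2) : ℕ) : ℝ) * (2 * ((((2 * cth 32 1 sS + 1) ^ 4 : ℕ) : ℝ) * (5 : ℝ) ^ 4)))) +
              (2 * ((4 : ℕ) : ℝ) + 2 * Real.log (2 * (4 : ℕ) + 1)) * 1 *
                (((max 1 (2 * 32 + 2) : ℕ) : ℝ) *
                    ((2 * (((2 * cth 32 1 sS + 1) ^ 4 : ℕ) : ℝ) * ((((2 * 32 + 1) ^ 4 : ℕ) : ℝ) * (4 * 2 ^ 4)) +
                        4 * ((((2 * cth 32 1 sS + 1) ^ 4 : ℕ) : ℝ) * (5 : ℝ) ^ 4)) / (1 - θc)) +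
                  4 * 2 ^ 4)) +
            10) + 8 * 2 ^ 4 * Real.log (2 * (4 : ℕ) + 1) ≤ θ) :
    (46042893350480000 : ℝ) < O.γ₀ * O.A₁ ^ 2 / 2 := by
  have h8 := half_gamma_A1_sq_gt_of_END3 (d := 4) h hslack hθc0 hθc1 hsS hθJ
  norm_num at h8
  exact h8

/-- **NO RECORD BELOW THE FLOOR**: if print's `½γ₀A₁² ≤ 8·8710^d`, NO choice of a record `C`, a slack `θ`, a stride `sS`
and a decay `θc` meets END v3's constants-side binders `ThresholdOK`, `hslack`, `hsS`, `hθc0`, `hθc1`, `hθJ` — on such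
print constants END v3 is vacuously true. [folklore] -/
theorem not_exists_END3_consts_of_le {d : ℕ} (hO : O.γ₀ * O.A₁ ^ 2 / 2 ≤ (8 : ℝ) * 8710 ^ d) :
    ¬ ∃ (C : T4PrintedShapeBanking.Consts) (θ θc : ℝ) (sS : ℕ),
      ThresholdOK C L rr β₀ ∧ C.a + θ ≤ O.γ₀ * O.A₁ ^ 2 / 2 ∧ 1 ≤ sS ∧ 0 ≤ θc ∧ θc < 1 ∧
      (2 +
            ((2 * (((2 * cth 32 1 sS + 1) ^ d : ℕ) : ℝ) * ((((2 * 32 + 1) ^ d : ℕ) : ℝ) * (4 * 2 ^ d)) +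
                  4 * ((((2 * cth 32 1 sS + 1) ^ d : ℕ) : ℝ) * (5 : ℝ) ^ d)) / (1 - θc) +
              2 * (2 * ((((2 * cth 32 1 sS + 1) ^ d : ℕ) : ℝ) * (5 : ℝ) ^ d))) +
            (2 * ((0 + 2 * Real.log (2 * d + 1)) + (2 * (d : ℝ) + 2 * Real.log (2 * d + 1)) *
                  (((max 1 (2 * 32 + 2) : ℕ) : ℝ) * (2 * ((((2 * cth 32 1 sS + 1) ^ d : ℕ) : ℝ) * (5 : ℝ) ^ d)))) +
              (2 * (d : ℝ) + 2 * Real.log (2 * d + 1)) * 1 *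
                (((max 1 (2 * 32 + 2) : ℕ) : ℝ) *
                    ((2 * (((2 * cth 32 1 sS + 1) ^ d : ℕ) : ℝ) * ((((2 * 32 + 1) ^ d : ℕ) : ℝ) * (4 * 2 ^ d)) +
                        4 * ((((2 * cth 32 1 sS + 1) ^ d : ℕ) : ℝ) * (5 : ℝ) ^ d)) / (1 - θc)) +
                  4 * 2 ^ d)) +
            10) + 8 * 2 ^ d * Real.log (2 * d + 1) ≤ θ := by
  rintro ⟨C, θ, θc, sS, h, hslack, hsS, hθc0, hθc1, hθJ⟩
  exact absurd (half_gamma_A1_sq_gt_of_END3 h hslack hθc0 hθc1 hsS hθJ) (not_lt.2 hO)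

end Demand

/-! ## §4 Above the demand the whole constants-side bundle is satisfiable -/

section Exist

variable {O : PrintedO1s}

/-- **ONE RECORD MEETING EVERY `C`-SIDE BINDER OF END v3 AND OF THE APEX, WITH A PRESCRIBED SLACK `θ < ½γ₀A₁²`**: for
`O.Pos`, `0 ≤ θ < ½γ₀A₁²`, any dimension `d`, refinement factor `L ≥ 1` and size exponent `rr`, the print-shaped record
over the margins `κ₁ := d·log L + 2·log 2`, `Eb := 0`, `μ := 1`, `E₀ := log (2 + birth mass)`, grid `n₁ := max 13
(fatWait 2d)`, profile `A₀ := 1`, `p₀ := rr·(d+2) + 1`, lowered by `θ` (`lowerA (printedConsts O ·) θ`), with `β₀ := 1∕L`,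
satisfies: `ThresholdOK`, `Dominates · O`, `0 < μ`, `κ₁`-largeness, `E₀`-largeness, `1 ≤ A₀`, `13 ≤ n₁`, `0 < E₂`,
`0 ≤ E₃`, `hslack : a + θ ≤ ½γ₀A₁²`, `0 < β₀`, `L·β₀ ≤ 1`. [folklore] -/
theorem exists_consts_END3 (hO : O.Pos) {θ : ℝ} (hθ : 0 ≤ θ) (hθO : θ < O.γ₀ * O.A₁ ^ 2 / 2) (d : ℕ) {L : ℕ}
    (hL : 1 ≤ L) (rr : ℕ) :
    ∃ (C : T4PrintedShapeBanking.Consts) (β₀ : ℝ), ThresholdOK C L rr β₀ ∧ Dominates C O ∧ 0 < C.μ ∧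
      (d : ℝ) * Real.log L + 2 * Real.log 2 ≤ C.κ₁ ∧ Real.log (2 + birthMass C) ≤ C.E₀ ∧ 1 ≤ C.A₀ ∧ 13 ≤ C.n₁ ∧
      0 < C.E₂ ∧ 0 ≤ C.E₃ ∧ C.a + θ ≤ O.γ₀ * O.A₁ ^ 2 / 2 ∧ 0 < β₀ ∧ (L : ℝ) * β₀ ≤ 1 := by
  -- the base record: grid, profile and margins
  let C₀ : T4PrintedShapeBanking.Consts :=
    { n₁ := max 13 (fatWait (2 * O.d)), dC := 2 * O.d, q' := O.d + 1, E₂ := 0, E₃ := 0,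
      κ₁ := (d : ℝ) * Real.log L + 2 * Real.log 2,
      E₀ := Real.log (2 + Real.exp (-0) * (Real.exp (-1) / (1 - Real.exp (-1)))),
      Eb := 0, μ := 1, a := 0, A₀ := 1, p₀ := rr * (O.d + 2) + 1 }
  have hL1 : (1 : ℝ) ≤ L := by exact_mod_cast hL
  have hκ : 0 ≤ C₀.κ₁ := by
    show 0 ≤ (d : ℝ) * Real.log L + 2 * Real.log 2
    have := Real.log_nonneg hL1
    have := Real.log_nonneg (show (1 : ℝ) ≤ 2 by norm_num)
    positivity
  have hbm : 0 ≤ Real.exp (-0) * (Real.exp (-1) / (1 - Real.exp (-1))) := by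
    have : Real.exp (-1) < 1 := Real.exp_lt_one_iff.2 (by norm_num)
    have : 0 < 1 - Real.exp (-1) := by linarith
    positivity
  have hE₀ : 0 ≤ C₀.E₀ := by
    show 0 ≤ Real.log (2 + Real.exp (-0) * (Real.exp (-1) / (1 - Real.exp (-1))))
    exact Real.log_nonneg (by linarith)
  have hn : fatWait (2 * O.d) ≤ C₀.n₁ := le_max_right _ _
  have hT : ThresholdOK (printedConsts O C₀) L rr (1 / L) :=
    thresholdOK_printedConsts C₀ hO hκ hE₀ le_rfl (by show (0 : ℝ) ≤ 1; norm_num) hn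
      (by show (0 : ℝ) < 1; norm_num) hL (by positivity) (by show rr * (O.d + 2) < rr * (O.d + 2) + 1; omega)
  have hD : Dominates (printedConsts O C₀) O := dominates_printedConsts C₀ hO
  have hθa : θ < (printedConsts O C₀).a := by rw [printedConsts_a]; exact hθO
  refine ⟨lowerA (printedConsts O C₀) θ, 1 / L, thresholdOK_lowerA hT hθa, dominates_lowerA hD hθ, ?_, ?_, ?_, ?_,
    ?_, ?_, ?_, slack_lowerA hD θ, by positivity, ?_⟩
  · show (0 : ℝ) < 1; norm_num
  · exact le_rfl
  · rw [birthMass_lowerA, lowerA_E₀]; exact le_rfl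
  · show (1 : ℝ) ≤ 1; norm_num
  · exact le_max_left _ _
  · show 0 < max (O.o80 * O.M ^ O.d * 64 ^ O.d) (O.o88 * (100 * O.M) ^ O.d)
    exact lt_of_lt_of_le (by have := hO.o80_pos; have := hO.M_pos; positivity) (le_max_left _ _)
  · exact printedConsts_E₃_nonneg C₀ hO
  · rw [mul_one_div, div_self (by positivity)]

/-- **THE CONSTANTS-SIDE BUNDLE OF END v3 IS INHABITED IFF PRINT's `½γ₀A₁²` EXCEEDS THE COUNT's CLASS-LINEAR
CONSTANT FOR SOME ADMISSIBLE STRIDE∕DECAY** (`O.Pos`, `L ≥ 1`): the binders `ThresholdOK`, `0 ≤ θ`, `hslack`, `hsS`,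
`hsmall`, `hθc0`, `hθc1`, `hθcs`, `hθJ` (verbatim) have a common witness `(C, θ, sS, θc, β₀)` iff
`ΘJ(d,sS,θc) + 8·2^d·log(2d+1) < ½γ₀A₁²` for some `(sS, θc)` meeting `hsS ∕ hsmall ∕ hθc0 ∕ hθc1 ∕ hθcs`. [folklore] -/
theorem END3_consts_iff (hO : O.Pos) (d : ℕ) {L : ℕ} (hL : 1 ≤ L) (rr : ℕ) :
    (∃ (C : T4PrintedShapeBanking.Consts) (θ θc : ℝ) (sS : ℕ) (β₀ : ℝ),
      ThresholdOK C L rr β₀ ∧ 0 ≤ θ ∧ C.a + θ ≤ O.γ₀ * O.A₁ ^ 2 / 2 ∧ 1 ≤ sS ∧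
      (((2 * cth 32 1 sS + 1) ^ d : ℕ) : ℝ) * (5 : ℝ) ^ d * ((max 1 (2 * 32 + 2) : ℕ) : ℝ) ≤
          (L : ℝ) ^ (sS / 2) / 2 ∧
      0 ≤ θc ∧ θc < 1 ∧ 1 / 2 ≤ θc ^ sS ∧
      (2 +
            ((2 * (((2 * cth 32 1 sS + 1) ^ d : ℕ) : ℝ) * ((((2 * 32 + 1) ^ d : ℕ) : ℝ) * (4 * 2 ^ d)) +
                  4 * ((((2 * cth 32 1 sS + 1) ^ d : ℕ) : ℝ) * (5 : ℝ) ^ d)) / (1 - θc) +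
              2 * (2 * ((((2 * cth 32 1 sS + 1) ^ d : ℕ) : ℝ) * (5 : ℝ) ^ d))) +
            (2 * ((0 + 2 * Real.log (2 * d + 1)) + (2 * (d : ℝ) + 2 * Real.log (2 * d + 1)) *
                  (((max 1 (2 * 32 + 2) : ℕ) : ℝ) * (2 * ((((2 * cth 32 1 sS + 1) ^ d : ℕ) : ℝ) * (5 : ℝ) ^ d)))) +
              (2 * (d : ℝ) + 2 * Real.log (2 * d + 1)) * 1 *
                (((max 1 (2 * 32 + 2) : ℕ) : ℝ) *
                    ((2 * (((2 * cth 32 1 sS + 1) ^ d : ℕ) : ℝ) * ((((2 * 32 + 1) ^ d : ℕ) : ℝ) * (4 * 2 ^ d)) +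
                        4 * ((((2 * cth 32 1 sS + 1) ^ d : ℕ) : ℝ) * (5 : ℝ) ^ d)) / (1 - θc)) +
                  4 * 2 ^ d)) +
            10) + 8 * 2 ^ d * Real.log (2 * d + 1) ≤ θ) ↔
    ∃ (θc : ℝ) (sS : ℕ), 1 ≤ sS ∧
      (((2 * cth 32 1 sS + 1) ^ d : ℕ) : ℝ) * (5 : ℝ) ^ d * ((max 1 (2 * 32 + 2) : ℕ) : ℝ) ≤
          (L : ℝ) ^ (sS / 2) / 2 ∧
      0 ≤ θc ∧ θc < 1 ∧ 1 / 2 ≤ θc ^ sS ∧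
      (2 +
            ((2 * (((2 * cth 32 1 sS + 1) ^ d : ℕ) : ℝ) * ((((2 * 32 + 1) ^ d : ℕ) : ℝ) * (4 * 2 ^ d)) +
                  4 * ((((2 * cth 32 1 sS + 1) ^ d : ℕ) : ℝ) * (5 : ℝ) ^ d)) / (1 - θc) +
              2 * (2 * ((((2 * cth 32 1 sS + 1) ^ d : ℕ) : ℝ) * (5 : ℝ) ^ d))) +
            (2 * ((0 + 2 * Real.log (2 * d + 1)) + (2 * (d : ℝ) + 2 * Real.log (2 * d + 1)) *
                  (((max 1 (2 * 32 + 2) : ℕ) : ℝ) * (2 * ((((2 * cth 32 1 sS + 1) ^ d : ℕ) : ℝ) * (5 : ℝ) ^ d)))) +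
              (2 * (d : ℝ) + 2 * Real.log (2 * d + 1)) * 1 *
                (((max 1 (2 * 32 + 2) : ℕ) : ℝ) *
                    ((2 * (((2 * cth 32 1 sS + 1) ^ d : ℕ) : ℝ) * ((((2 * 32 + 1) ^ d : ℕ) : ℝ) * (4 * 2 ^ d)) +
                        4 * ((((2 * cth 32 1 sS + 1) ^ d : ℕ) : ℝ) * (5 : ℝ) ^ d)) / (1 - θc)) +
                  4 * 2 ^ d)) +
            10) + 8 * 2 ^ d * Real.log (2 * d + 1) < O.γ₀ * O.A₁ ^ 2 / 2 := by
  constructor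
  · rintro ⟨C, θ, θc, sS, β₀, h, -, hslack, hsS, hsmall, hθc0, hθc1, hθcs, hθJ⟩
    exact ⟨θc, sS, hsS, hsmall, hθc0, hθc1, hθcs, demand_of_slack h hslack hθJ⟩
  · rintro ⟨θc, sS, hsS, hsmall, hθc0, hθc1, hθcs, hlt⟩
    have hfloor := theta_floor (d := d) (sS := sS) hθc0 hθc1 hsS le_rfl
    have hθ0 := le_trans (by positivity : (0 : ℝ) ≤ 8 * 8710 ^ d) hfloor
    obtain ⟨C, β₀, h, -, -, -, -, -, -, -, -, hslack, -, -⟩ := exists_consts_END3 hO hθ0 hlt d hL rr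
    exact ⟨C, _, θc, sS, β₀, h, hθ0, hslack, hsS, hsmall, hθc0, hθc1, hθcs, le_rfl⟩

end Exist

/-! ## §5 Sanity -/

namespace Sanity

/-- the stride∕decay arithmetic is satisfiable already at `L = 2`, `d = 4` (by `exists_stride_decay`) [folklore] -/
example : ∃ sS : ℕ, ∃ θc : ℝ, 1 ≤ sS ∧
    (((2 * cth 32 1 sS + 1) ^ 4 : ℕ) : ℝ) * (5 : ℝ) ^ 4 * ((max 1 (2 * 32 + 2) : ℕ) : ℝ) ≤ ((2 : ℕ) : ℝ) ^ (sS / 2) / 2 ∧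
    0 ≤ θc ∧ θc < 1 ∧ 1 / 2 ≤ θc ^ sS :=
  exists_stride_decay 4 le_rfl

end Sanity

end

end Summit.QuantumFields.BalabanUV.T4Continuum.HistoryConstantsSlackT3b
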